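import Summits.ResolutionOfSingularities.ResolutionOfSingularities.Theorems.RadicialJungCleanModelsGiraudPointBound
import Summits.ResolutionOfSingularities.ResolutionOfSingularities.Theorems.RadicialJungCleanModelsGiraudInitialFormLength
import HarnessLib

/-!
# Route `RadicialJung`, crux `CleanModels` (stmt-15917): Giraud 2.5, cases (A) and (B) — the
# length side of Lemme 2.3 (ii)

Support file (OURS) for PROGRAMME-clean-dim2 (K2, W8.1; `K2-DESIGN.md` §5.3; division of labour
with res-L0-w81-pv-2: this is the LENGTH side, the log-content side `J(X′,ω′,E′) ⊇ xᵃ·D′` is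
pv-2's (C2)). J. Giraud, Bull. SMF 111 (1983), 2.5 (pp. 118–119): with `ω = xᵃ(A dx/x + B dy +
Σ Cᵢ duᵢ)`, `D = D(J) = (A, B, Cᵢ)` of order `m` and colength `c`, and in the chart of the blowing
up where the old divisor `E(ω)` becomes `{z = 0}` and the exceptional curve `{y = 0}`:
`J′ ⊇ xᵃ(A + yB, A, Cᵢ) = xᵃ·D′`, `D′ = (A, yB, Cᵢ)`; "(A) Si `ord(B) < ord(A, Cᵢ)`, on a `m = ord B`
et `m′ = m + 1`, d'où `H ⊂ H′ ⊂ R′` … `(k(ξ′):k(ξ))·c(X′,ω′,ξ′) ≤ c(X,ω,ξ) − m(m+1)/2`. (B) Si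
`ord(B) ≥ ord(A, Cᵢ)`, on a `m′ = m = ord(A, Cᵢ)` et `H′ ⊂ H ⊂ R′` et de plus `H/H′` est un
quotient de `R′/(yR′ + y⁻ᵐ(A, Cᵢ)R′)` … donc `long(H/H′) ≤ m`", giving 2.3 (ii):
`Σ (k(ξ′):k(ξ))·c′ ≤ c − m(m−1)/2`.

Here, in the chart `𝒜 = R[y/x]` of `RadicialJungCleanModelsGiraudTotalColength.lean` (exceptional
equation `x`; Giraud's `X″` with his `y` our `x`), for ideals `D₀ ⊆ R` (his `(A, Cᵢ)`), an element
`B` and `D = D₀ + (B)`, `D′ = D₀ + (xB)`, all `R`-lengths WEIGHTED (residue degrees included):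

* `length_quot_comap_eq_add_of_le_of_le` — `λ(N/D′) = λ(N/D) + λ(D/D′)` for `D′ ≤ D ≤ N`;
* `length_quot_weakTransform_caseB_add_le` — **case (B)** (`D₀ ≤ 𝔪ᵐ` with an element of
  order `m`, `B ∈ 𝔪ᵐ`, `R/D` of finite length):
  `λ_R(𝔪ᵐ𝒜/D′𝒜) + m(m+1)/2 ≤ λ_R(R/D) + m` (the weighted colength of the weak transform of `D′`
  over the whole chart is `≤ c − m(m−1)/2`);
* `length_quot_weakTransform_caseA_add_le` — **case (A)** (`D₀ ≤ 𝔪ᵐ⁺¹`, `B ∈ 𝔪ᵐ ∖ 𝔪ᵐ⁺¹`):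
  `λ_R(𝔪ᵐ⁺¹𝒜/D′𝒜) + m(m+1)/2 ≤ λ_R(R/D)`.

* `length_mul_length_atPrime_caseB_add_le`, `length_mul_length_atPrime_caseA_add_le` — the same at
  ONE point `ξ′ = Q` of the chart (`[κ(ξ′):κ(ξ)]·λ(𝒪_{X′,ξ′}/(D′A : xᵐ)𝒪) + m(m+1)/2 ≤ …`, via
  `RadicialJungCleanModelsWeightedColengthAtPoint.lean`); points of the other chart by the
  symmetry `x ↔ y`. References: J. Giraud, Bull. SMF 111 (1983), 2.5 [Giraud1983]. Nothing here is a statement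
of Hironaka's manuscript or bears on the summit directly.
-/

noncomputable section

set_option linter.dupNamespace false -- mandated namespace of this single-conjunct summit

open IsLocalRing Literature.AlgebraicGeometry.Resolution

namespace Summit.ResolutionOfSingularities.ResolutionOfSingularities.Theorems.RadicialJung.CleanModels

universe u v

section Nested

variable {A : Type u} [Ring A] {V : Type v} [AddCommGroup V] [Module A V]

/-- **Three nested submodules**: `λ(N/D′) = λ(N/D) + λ(D/D′)` for `D′ ≤ D ≤ N` (subquotients
`↥N ⧸ D.comap N.subtype`; exact sequence `0 → D/D′ → N/D′ → N/D → 0`). [folklore] -/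
theorem length_quot_comap_eq_add_of_le_of_le {D' D N : Submodule A V} (h₁ : D' ≤ D) (h₂ : D ≤ N) :
    Module.length A (↥N ⧸ D'.comap N.subtype) =
      Module.length A (↥N ⧸ D.comap N.subtype) + Module.length A (↥D ⧸ D'.comap D.subtype) := by
  let f : (↥D ⧸ D'.comap D.subtype) →ₗ[A] ↥N ⧸ D'.comap N.subtype :=
    Submodule.mapQ _ _ (Submodule.inclusion h₂) (fun d hd => by
      simp only [Submodule.mem_comap, Submodule.subtype_apply, Submodule.coe_inclusion] at hd ⊢
      exact hd)
  let g : (↥N ⧸ D'.comap N.subtype) →ₗ[A] ↥N ⧸ D.comap N.subtype :=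
    Submodule.factor (Submodule.comap_mono h₁)
  have hf : Function.Injective f := by
    rw [← LinearMap.ker_eq_bot, eq_bot_iff]
    intro q hq
    induction q using Submodule.Quotient.induction_on with
    | H d =>
      rw [LinearMap.mem_ker, Submodule.mapQ_apply, Submodule.Quotient.mk_eq_zero, Submodule.mem_comap,
        Submodule.subtype_apply, Submodule.coe_inclusion] at hq
      rw [Submodule.mem_bot, Submodule.Quotient.mk_eq_zero, Submodule.mem_comap]
      exact hq
  have hg : Function.Surjective g := Submodule.factor_surjective _
  have hfg : Function.Exact f g := by
    intro q
    induction q using Submodule.Quotient.induction_on with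
    | H n =>
      change (Submodule.Quotient.mk n : ↥N ⧸ D.comap N.subtype) = 0 ↔ _
      rw [Submodule.Quotient.mk_eq_zero, Submodule.mem_comap, Submodule.subtype_apply]
      constructor
      · intro hn
        refine ⟨Submodule.Quotient.mk ⟨(n : V), hn⟩, ?_⟩
        rw [Submodule.mapQ_apply]
        rfl
      · rintro ⟨q, hq⟩
        induction q using Submodule.Quotient.induction_on with
        | H d =>
          rw [Submodule.mapQ_apply, Submodule.Quotient.eq, Submodule.mem_comap,
            Submodule.subtype_apply, Submodule.coe_sub, Submodule.coe_inclusion] at hq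
          have : (n : V) = d - ((d : V) - n) := by abel
          rw [this]
          exact sub_mem d.2 (h₁ hq)
  rw [Module.length_eq_add_of_exact f g hf hg hfg, add_comm]

end Nested

variable {K : Type u} [Field K] {R : Subring K} [IsRegularLocalRing R] {x y : R}

/-- **Giraud 2.5, case (B), length side.** Let `(R, 𝔪 = (x, y)) ⊆ K` be a two-dimensional
regular local ring, `𝒜 = R[y/x]` the chart of the blowing up of the closed point (exceptional
equation `x`), `D₀ ⊆ 𝔪ᵐ` an ideal containing an element `φ₀ ∉ 𝔪ᵐ⁺¹`, `B ∈ 𝔪ᵐ`, `D = D₀ + (B)`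
with `R/D` of finite length, and `D′ = D₀ + (xB)`. Then
`λ_R(𝔪ᵐ𝒜/D′𝒜) + m(m+1)/2 ≤ λ_R(R/D) + m`, i.e. the weighted colength of the weak transform of
`D′` over the chart is at most `λ(R/D) − m(m−1)/2`: `λ(𝔪ᵐ𝒜/D′𝒜) = λ(𝔪ᵐ𝒜/D𝒜) + λ(D𝒜/D′𝒜)`,
the first is `≤ λ(R/D) − m(m+1)/2` (2.1.1, one chart, `length_quot_weakTransform_chart_add_le`),
and `D𝒜/D′𝒜 = (D′𝒜 + B𝒜)/D′𝒜` is a quotient of `𝒜/(x𝒜 + (φ₀/xᵐ)𝒜)`, of length `≤ m`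
(`length_quot_sup_span_singleton_mul_le`, `length_quot_adjoin_span_exceptional_sup_weakTransform_le`).
[cite: Giraud1983, 2.5 (B) (p. 119)] -/
theorem length_quot_weakTransform_caseB_add_le (hdim : ringKrullDim R = 2)
    (hm : maximalIdeal R = Ideal.span {x, y}) {D₀ : Ideal R} {φ₀ B : R} {m : ℕ}
    (hD₀ : D₀ ≤ maximalIdeal R ^ m) (hφ₀ : φ₀ ∈ D₀) (hφ₀' : φ₀ ∉ maximalIdeal R ^ (m + 1))
    (hB : B ∈ maximalIdeal R ^ m) (hfin : IsFiniteLength R (R ⧸ (D₀ ⊔ Ideal.span {B})))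
    {𝒜 : Submodule R K}
    (h𝒜 : 𝒜 = Subalgebra.toSubmodule (Algebra.adjoin R {((y : R) : K) / ((x : R) : K)})) :
    Module.length R (↥(maximalIdeal R ^ m • 𝒜) ⧸
        ((D₀ ⊔ Ideal.span {x * B}) • 𝒜).comap (maximalIdeal R ^ m • 𝒜).subtype) +
      ((m * (m + 1) / 2 : ℕ) : ℕ∞) ≤
    Module.length R (R ⧸ (D₀ ⊔ Ideal.span {B})) + m := by
  subst h𝒜
  set 𝒜 := Subalgebra.toSubmodule (Algebra.adjoin R {((y : R) : K) / ((x : R) : K)}) with h𝒜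
  set D : Ideal R := D₀ ⊔ Ideal.span {B} with hDdef
  set D' : Ideal R := D₀ ⊔ Ideal.span {x * B} with hD'def
  set N : Submodule R K := maximalIdeal R ^ m • 𝒜 with hNdef
  set P : K := ((φ₀ : R) : K) / ((x : R) : K) ^ m with hPdef
  have hx0 : x ≠ 0 := fun h => fst_not_mem_sq hdim hm (by rw [h]; exact Ideal.zero_mem _)
  have hx0K : ((x : R) : K) ≠ 0 := fun e => hx0 (Subtype.ext e)
  have hxm : x ∈ maximalIdeal R := hm ▸ Ideal.subset_span (by simp)
  have hD : D ≤ maximalIdeal R ^ m :=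
    sup_le hD₀ ((Ideal.span_singleton_le_iff_mem _).mpr hB)
  have hDnot : ¬ D ≤ maximalIdeal R ^ (m + 1) := fun h => hφ₀' (h (Submodule.mem_sup_left hφ₀))
  have hxB : x * B ∈ D' := Submodule.mem_sup_right (Ideal.mem_span_singleton_self _)
  -- `D′𝒜 ≤ D𝒜 ≤ N` and `D𝒜 = D′𝒜 + B𝒜`
  have hA𝒜 : ∀ a ∈ 𝒜, ((x : R) : K) * a ∈ 𝒜 := fun a ha =>
    (Algebra.adjoin R _).mul_mem (Subalgebra.algebraMap_mem _ x) ha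
  have hD'D : D' • 𝒜 ≤ D • 𝒜 := by
    rw [hD'def, hDdef, Submodule.sup_smul, Submodule.sup_smul]
    refine sup_le_sup_left (Submodule.smul_le.mpr fun r hr a ha => ?_) _
    obtain ⟨c, rfl⟩ := Ideal.mem_span_singleton'.mp hr
    have e : (c * (x * B)) • a = (c * B) • (((x : R) : K) * a) := by
      simp only [Algebra.smul_def, Algebra.algebraMap_ofSubsemiring_apply, Subring.coe_mul]
      ring
    rw [e]
    exact Submodule.smul_mem_smul (Ideal.mem_span_singleton'.mpr ⟨c, rfl⟩) (hA𝒜 a ha)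
  have hDN : D • 𝒜 ≤ N := Submodule.smul_mono_left hD
  have hDeq : D • 𝒜 = D' • 𝒜 ⊔ Submodule.span R {((B : R) : K)} * 𝒜 := by
    refine le_antisymm ?_ (sup_le hD'D ?_)
    · rw [hDdef, Submodule.sup_smul]
      refine sup_le ((Submodule.smul_mono_left le_sup_left).trans le_sup_left) ?_
      refine Submodule.smul_le.mpr fun r hr a ha => ?_
      obtain ⟨c, rfl⟩ := Ideal.mem_span_singleton'.mp hr
      refine Submodule.mem_sup_right
        (Submodule.mem_span_singleton_mul.mpr ⟨c • a, 𝒜.smul_mem c ha, ?_⟩)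
      simp only [Algebra.smul_def, Algebra.algebraMap_ofSubsemiring_apply, Subring.coe_mul]
      ring
    · refine Submodule.mul_le.mpr fun b hb a ha => ?_
      obtain ⟨c, rfl⟩ := Submodule.mem_span_singleton.mp hb
      have e : c • ((B : R) : K) * a = (c * B) • a := by
        simp only [Algebra.smul_def, Algebra.algebraMap_ofSubsemiring_apply, Subring.coe_mul]
      rw [e]
      exact Submodule.smul_mem_smul
        (Submodule.mem_sup_right (Ideal.mem_span_singleton'.mpr ⟨c, rfl⟩) : c * B ∈ D) ha
  -- Step 1: `λ(N/D′𝒜) = λ(N/D𝒜) + λ(D𝒜/D′𝒜)`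
  have hstep1 := length_quot_comap_eq_add_of_le_of_le (A := R) hD'D hDN
  -- Step 2: `λ(D𝒜/D′𝒜) ≤ m`
  have hBK : ∃ a' ∈ 𝒜, ((x : R) : K) ^ m * a' = ((B : R) : K) := by
    have : ((B : R) : K) ∈ maximalIdeal R ^ m • 𝒜 :=
      map_linearMap_le_smul_toSubmodule _ _ ⟨B, hB, rfl⟩
    rw [maximalIdeal_pow_smul_toSubmodule_adjoin hm hx0, mem_span_singleton_smul_toSubmodule_iff]
      at this
    obtain ⟨a', ha', h⟩ := this
    exact ⟨a', ha', by rw [← h, Subring.coe_pow]⟩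
  obtain ⟨a', ha', hBa'⟩ := hBK
  have hI : ∀ i ∈ Ideal.span {x} • 𝒜 ⊔ Submodule.span R {P} * 𝒜, ((B : R) : K) * i ∈ D' • 𝒜 := by
    intro i hi
    obtain ⟨i₁, hi₁, i₂, hi₂, rfl⟩ := Submodule.mem_sup.mp hi
    rw [mem_span_singleton_smul_toSubmodule_iff] at hi₁
    obtain ⟨a₁, ha₁, rfl⟩ := hi₁
    obtain ⟨a₂, ha₂, rfl⟩ := Submodule.mem_span_singleton_mul.mp hi₂
    rw [mul_add]
    refine add_mem ?_ ?_
    · -- `B · (x a₁) = (xB) · a₁ ∈ D′𝒜`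
      have e : ((B : R) : K) * (((x : R) : K) * a₁) = (x * B) • a₁ := by
        simp only [Algebra.smul_def, Algebra.algebraMap_ofSubsemiring_apply, Subring.coe_mul]
        ring
      rw [e]
      exact Submodule.smul_mem_smul hxB ha₁
    · -- `B · (P a₂) = φ₀ · (a′ a₂) ∈ D₀𝒜 ⊆ D′𝒜`
      have e : ((B : R) : K) * (P * a₂) = φ₀ • (a' * a₂) := by
        rw [Algebra.smul_def, Algebra.algebraMap_ofSubsemiring_apply, hPdef, ← hBa']
        field_simp
      rw [e]
      exact Submodule.smul_mem_smul (Submodule.mem_sup_left hφ₀ : φ₀ ∈ D')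
        ((Algebra.adjoin R _).mul_mem ha' ha₂)
  have hstep2 : Module.length R (↥(D • 𝒜) ⧸ (D' • 𝒜).comap (D • 𝒜).subtype) ≤ m := by
    rw [hDeq]
    exact (length_quot_sup_span_singleton_mul_le 𝒜 (D' • 𝒜) _ ((B : R) : K) hI).trans
      (length_quot_adjoin_span_exceptional_sup_weakTransform_le hdim hm (hD₀ hφ₀) hφ₀' rfl)
  -- Step 3: `λ(N/D𝒜) + m(m+1)/2 ≤ λ(R/D)`
  have hstep3 := length_quot_weakTransform_chart_add_le (K := K) hdim hm hD hDnot hfin rfl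
  rw [length_quotient_pow_maximalIdeal_eq hdim m] at hstep3
  -- assemble
  calc Module.length R (↥N ⧸ (D' • 𝒜).comap N.subtype) + ((m * (m + 1) / 2 : ℕ) : ℕ∞)
      = Module.length R (↥N ⧸ (D • 𝒜).comap N.subtype) + ((m * (m + 1) / 2 : ℕ) : ℕ∞) +
          Module.length R (↥(D • 𝒜) ⧸ (D' • 𝒜).comap (D • 𝒜).subtype) := by
        rw [hstep1, add_right_comm]
    _ ≤ Module.length R (R ⧸ D) + m := add_le_add hstep3 hstep2

/-- **Giraud 2.5, case (A), length side.** With the notation of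
`length_quot_weakTransform_caseB_add_le` but `D₀ ⊆ 𝔪ᵐ⁺¹` and `B ∈ 𝔪ᵐ ∖ 𝔪ᵐ⁺¹` (so
`m = ord D = ord B < ord D₀` and `ord D′ = m + 1`): `λ_R(𝔪ᵐ⁺¹𝒜/D′𝒜) + m(m+1)/2 ≤ λ_R(R/D)` —
"on a `H ⊂ H′ ⊂ R′`": multiplication by `x` maps `𝔪ᵐ𝒜` onto `𝔪ᵐ⁺¹𝒜` and `D𝒜` into `D′𝒜`, so
`𝔪ᵐ⁺¹𝒜/D′𝒜` is a quotient of `𝔪ᵐ𝒜/D𝒜`, whose length is `≤ λ(R/D) − m(m+1)/2` (2.1.1, one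
chart). [cite: Giraud1983, 2.5 (A) (p. 118)] -/
theorem length_quot_weakTransform_caseA_add_le (hdim : ringKrullDim R = 2)
    (hm : maximalIdeal R = Ideal.span {x, y}) {D₀ : Ideal R} {B : R} {m : ℕ}
    (hD₀ : D₀ ≤ maximalIdeal R ^ (m + 1)) (hB : B ∈ maximalIdeal R ^ m)
    (hB' : B ∉ maximalIdeal R ^ (m + 1)) (hfin : IsFiniteLength R (R ⧸ (D₀ ⊔ Ideal.span {B})))
    {𝒜 : Submodule R K}
    (h𝒜 : 𝒜 = Subalgebra.toSubmodule (Algebra.adjoin R {((y : R) : K) / ((x : R) : K)})) :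
    Module.length R (↥(maximalIdeal R ^ (m + 1) • 𝒜) ⧸
        ((D₀ ⊔ Ideal.span {x * B}) • 𝒜).comap (maximalIdeal R ^ (m + 1) • 𝒜).subtype) +
      ((m * (m + 1) / 2 : ℕ) : ℕ∞) ≤
    Module.length R (R ⧸ (D₀ ⊔ Ideal.span {B})) := by
  subst h𝒜
  set 𝒜 := Subalgebra.toSubmodule (Algebra.adjoin R {((y : R) : K) / ((x : R) : K)}) with h𝒜
  set D : Ideal R := D₀ ⊔ Ideal.span {B} with hDdef
  set D' : Ideal R := D₀ ⊔ Ideal.span {x * B} with hD'def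
  set N : Submodule R K := maximalIdeal R ^ m • 𝒜 with hNdef
  set N' : Submodule R K := maximalIdeal R ^ (m + 1) • 𝒜 with hN'def
  have hx0 : x ≠ 0 := fun h => fst_not_mem_sq hdim hm (by rw [h]; exact Ideal.zero_mem _)
  have hxm : x ∈ maximalIdeal R := hm ▸ Ideal.subset_span (by simp)
  have hD : D ≤ maximalIdeal R ^ m :=
    sup_le (hD₀.trans (Ideal.pow_le_pow_right (Nat.le_succ m)))
      ((Ideal.span_singleton_le_iff_mem _).mpr hB)
  have hDnot : ¬ D ≤ maximalIdeal R ^ (m + 1) := fun h =>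
    hB' (h (Submodule.mem_sup_right (Ideal.mem_span_singleton_self B)))
  -- `N′ = x • N`
  have hN'eq : N' = Ideal.span {x} • N := by
    rw [hN'def, hNdef, pow_succ, Submodule.mul_smul, maximalIdeal_smul_toSubmodule_adjoin hm hx0,
      ← Submodule.mul_smul, mul_comm, Submodule.mul_smul]
  -- multiplication by `x` : `N → N′`, carrying `D𝒜` into `D′𝒜`
  have hμmem : ∀ n : ↥N, ((x : R) : K) * (n : K) ∈ N' := fun n => by
    rw [hN'eq, Submodule.ideal_span_singleton_smul, Submodule.mem_smul_pointwise_iff_exists]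
    exact ⟨n, n.2, by rw [Algebra.smul_def, Algebra.algebraMap_ofSubsemiring_apply]⟩
  let μ : ↥N →ₗ[R] ↥N' :=
    { toFun := fun n => ⟨((x : R) : K) * (n : K), hμmem n⟩
      map_add' := fun n n' => Subtype.ext (by simp [mul_add])
      map_smul' := fun c n => Subtype.ext (by
        simp [Algebra.smul_def, Algebra.algebraMap_ofSubsemiring_apply, mul_left_comm]) }
  have hμ : ∀ n : ↥N, (μ n : K) = ((x : R) : K) * (n : K) := fun n => rfl
  have hμs : Function.Surjective μ := by
    rintro ⟨n', hn'⟩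
    have h := hn'
    rw [hN'eq, Submodule.ideal_span_singleton_smul, Submodule.mem_smul_pointwise_iff_exists] at h
    obtain ⟨n, hn, rfl⟩ := h
    exact ⟨⟨n, hn⟩, Subtype.ext (by
      rw [hμ]; simp [Algebra.smul_def, Algebra.algebraMap_ofSubsemiring_apply])⟩
  have hμD : (D • 𝒜).comap N.subtype ≤ ((D' • 𝒜).comap N'.subtype).comap μ := by
    intro n hn
    rw [Submodule.mem_comap, Submodule.subtype_apply] at hn
    rw [Submodule.mem_comap, Submodule.mem_comap, Submodule.subtype_apply, hμ]
    -- `x · (D𝒜) ⊆ D′𝒜`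
    refine Submodule.smul_induction_on (p := fun v => ((x : R) : K) * v ∈ D' • 𝒜) hn ?_ ?_
    · intro d hd a ha
      rw [hDdef] at hd
      obtain ⟨d₀, hd₀, b, hb, rfl⟩ := Submodule.mem_sup.mp hd
      obtain ⟨c, rfl⟩ := Ideal.mem_span_singleton'.mp hb
      have e : ((x : R) : K) * ((d₀ + c * B) • a) =
          d₀ • (((x : R) : K) * a) + (c * (x * B)) • a := by
        simp only [Algebra.smul_def, Algebra.algebraMap_ofSubsemiring_apply, Subring.coe_mul,
          Subring.coe_add]
        ring
      rw [e]
      exact add_mem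
        (Submodule.smul_mem_smul (Submodule.mem_sup_left hd₀ : d₀ ∈ D')
          ((Algebra.adjoin R _).mul_mem (Subalgebra.algebraMap_mem _ x) ha))
        (Submodule.smul_mem_smul (Submodule.mem_sup_right
          (Ideal.mem_span_singleton'.mpr ⟨c, rfl⟩) : c * (x * B) ∈ D') ha)
    · intro v w hv hw
      rw [mul_add]
      exact add_mem hv hw
  -- `N′/D′𝒜` is a quotient of `N/D𝒜`
  have hsurj : Function.Surjective (Submodule.mapQ _ _ μ hμD) := by
    intro q
    induction q using Submodule.Quotient.induction_on with
    | H n' =>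
      obtain ⟨n, rfl⟩ := hμs n'
      exact ⟨Submodule.Quotient.mk n, rfl⟩
  have hstep := length_quot_weakTransform_chart_add_le (K := K) hdim hm hD hDnot hfin rfl
  rw [length_quotient_pow_maximalIdeal_eq hdim m] at hstep
  exact (add_le_add (Module.length_le_of_surjective _ hsurj) le_rfl).trans hstep

/-! ## The same at one point of the chart -/

/-- **Case (B) at one point.** With the notation of `length_quot_weakTransform_caseB_add_le`, for
any `R`-algebra structure on `A = R[y/x]` with structure map the inclusion, every maximal ideal
`Q` of `A` containing the weak transform `(D′A : xᵐ)` and any localization `T = A_Q`: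
`λ_R(A/Q) · λ_T(T/(D′A : xᵐ)T) + m(m+1)/2 ≤ λ_R(R/D) + m` — Giraud's
`(k(ξ′):k(ξ))·c(X′,ω′,ξ′) ≤ c(X,ω,ξ) − m(m−1)/2` for the point `ξ′ = Q`, granted
`D(J′)_{ξ′} ⊇ (D′A : xᵐ)_{ξ′}` (the log-content side). [cite: Giraud1983, 2.5 (B) (p. 119)] -/
theorem length_mul_length_atPrime_caseB_add_le (hdim : ringKrullDim R = 2)
    (hm : maximalIdeal R = Ideal.span {x, y}) {D₀ : Ideal R} {φ₀ B : R} {m : ℕ}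
    (hD₀ : D₀ ≤ maximalIdeal R ^ m) (hφ₀ : φ₀ ∈ D₀) (hφ₀' : φ₀ ∉ maximalIdeal R ^ (m + 1))
    (hB : B ∈ maximalIdeal R ^ m) (hfin : IsFiniteLength R (R ⧸ (D₀ ⊔ Ideal.span {B})))
    [Algebra R (chartAdjoin (K := K) x y)]
    (halg : algebraMap R (chartAdjoin (K := K) x y) = chartIncl x y)
    (Q : Ideal (chartAdjoin (K := K) x y)) [Q.IsMaximal]
    (hWQ : weakTransformChart x y (D₀ ⊔ Ideal.span {x * B}) m ≤ Q)
    (T : Type u) [CommRing T] [Algebra (chartAdjoin (K := K) x y) T] [IsLocalization.AtPrime T Q] :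
    Module.length R (chartAdjoin (K := K) x y ⧸ Q) *
        Module.length T (T ⧸ (weakTransformChart x y (D₀ ⊔ Ideal.span {x * B}) m).map
          (algebraMap (chartAdjoin (K := K) x y) T)) +
      ((m * (m + 1) / 2 : ℕ) : ℕ∞) ≤
    Module.length R (R ⧸ (D₀ ⊔ Ideal.span {B})) + m := by
  have hx0 : x ≠ 0 := fun h => fst_not_mem_sq hdim hm (by rw [h]; exact Ideal.zero_mem _)
  set D' : Ideal R := D₀ ⊔ Ideal.span {x * B} with hD'def
  have h1 := length_quot_weakTransform_caseB_add_le (K := K) hdim hm hD₀ hφ₀ hφ₀' hB hfin rfl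
  have h2 := length_restrictScalars_quotient_weakTransformChart_eq (K := K) hm hx0 D' m halg rfl
  -- `A/(D′A : xᵐ)` has finite length over `A`
  have hfinA : IsFiniteLength (chartAdjoin (K := K) x y)
      (chartAdjoin (K := K) x y ⧸ weakTransformChart x y D' m) := by
    rw [← Module.length_ne_top_iff]
    have h3 := length_quotient_weakTransformChart_le (K := K) hm hx0 D' m
      (𝒜 := Subalgebra.toSubmodule (Algebra.adjoin R {((y : R) : K) / ((x : R) : K)})) rfl
    have h4 : Module.length R (R ⧸ (D₀ ⊔ Ideal.span {B})) + (m : ℕ∞) ≠ ⊤ :=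
      WithTop.add_ne_top.mpr ⟨Module.length_ne_top_iff.mpr hfin, WithTop.coe_ne_top⟩
    intro htop
    rw [htop, top_le_iff] at h3
    rw [h3, top_add, top_le_iff] at h1
    exact h4 h1
  have h5 := length_quotient_mul_length_atPrime_le (R := R) (weakTransformChart x y D' m) Q hWQ
    hfinA T
  rw [h2] at h5
  exact (add_le_add h5 le_rfl).trans h1

/-- **Case (A) at one point.** With the notation of `length_quot_weakTransform_caseA_add_le`
(`ord D′ = m + 1`), for every maximal `Q ⊇ (D′A : xᵐ⁺¹)` of `A = R[y/x]` and `T = A_Q`: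
`λ_R(A/Q) · λ_T(T/(D′A : xᵐ⁺¹)T) + m(m+1)/2 ≤ λ_R(R/D)`. [cite: Giraud1983, 2.5 (A) (p. 118)] -/
theorem length_mul_length_atPrime_caseA_add_le (hdim : ringKrullDim R = 2)
    (hm : maximalIdeal R = Ideal.span {x, y}) {D₀ : Ideal R} {B : R} {m : ℕ}
    (hD₀ : D₀ ≤ maximalIdeal R ^ (m + 1)) (hB : B ∈ maximalIdeal R ^ m)
    (hB' : B ∉ maximalIdeal R ^ (m + 1)) (hfin : IsFiniteLength R (R ⧸ (D₀ ⊔ Ideal.span {B})))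
    [Algebra R (chartAdjoin (K := K) x y)]
    (halg : algebraMap R (chartAdjoin (K := K) x y) = chartIncl x y)
    (Q : Ideal (chartAdjoin (K := K) x y)) [Q.IsMaximal]
    (hWQ : weakTransformChart x y (D₀ ⊔ Ideal.span {x * B}) (m + 1) ≤ Q)
    (T : Type u) [CommRing T] [Algebra (chartAdjoin (K := K) x y) T] [IsLocalization.AtPrime T Q] :
    Module.length R (chartAdjoin (K := K) x y ⧸ Q) *
        Module.length T (T ⧸ (weakTransformChart x y (D₀ ⊔ Ideal.span {x * B}) (m + 1)).map
          (algebraMap (chartAdjoin (K := K) x y) T)) +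
      ((m * (m + 1) / 2 : ℕ) : ℕ∞) ≤
    Module.length R (R ⧸ (D₀ ⊔ Ideal.span {B})) := by
  have hx0 : x ≠ 0 := fun h => fst_not_mem_sq hdim hm (by rw [h]; exact Ideal.zero_mem _)
  set D' : Ideal R := D₀ ⊔ Ideal.span {x * B} with hD'def
  have h1 := length_quot_weakTransform_caseA_add_le (K := K) hdim hm hD₀ hB hB' hfin rfl
  have h2 := length_restrictScalars_quotient_weakTransformChart_eq (K := K) hm hx0 D' (m + 1)
    halg rfl
  have hfinA : IsFiniteLength (chartAdjoin (K := K) x y)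
      (chartAdjoin (K := K) x y ⧸ weakTransformChart x y D' (m + 1)) := by
    rw [← Module.length_ne_top_iff]
    have h3 := length_quotient_weakTransformChart_le (K := K) hm hx0 D' (m + 1)
      (𝒜 := Subalgebra.toSubmodule (Algebra.adjoin R {((y : R) : K) / ((x : R) : K)})) rfl
    have h4 : Module.length R (R ⧸ (D₀ ⊔ Ideal.span {B})) ≠ ⊤ := Module.length_ne_top_iff.mpr hfin
    intro htop
    rw [htop, top_le_iff] at h3
    rw [h3, top_add, top_le_iff] at h1
    exact h4 h1
  have h5 := length_quotient_mul_length_atPrime_le (R := R) (weakTransformChart x y D' (m + 1))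
    Q hWQ hfinA T
  rw [h2] at h5
  exact (add_le_add h5 le_rfl).trans h1

end Summit.ResolutionOfSingularities.ResolutionOfSingularities.Theorems.RadicialJung.CleanModels

end
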